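import Summits.BirchSwinnertonDyer.BirchSwinnertonDyer.Theorems.GenusKolyvaginAtTwoTorsionCellSELBorderedImage
import Mathlib.Tactic.ReduceModChar
import HarnessLib

/-!
# SEL (iso-class Selmer pair law), C1-C: the fibres of the unified `C₁` system over the scalars

Crux R″ `RankOneTwoTorsionResidualAtTwo` (stmt-27478), LINE 49 «full_vertex», SUPPORT stub SEL
`IsoClassSelmerPairLawAtTwo`, the `C₁` conjunct (LEAD memo `Cruxes/…/Lines/torsion_cell_full_vertex_SEL_C1_road_g36.md`,
§3–§4 (FIBRE)).  The unified `𝔽₂`-linear system `SysC1` in the scalars `s = (σ, τ₁, τ₂, γ₁, γ₂)` and the vectors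
`χ₁, χ₂ : Q → 𝔽₂` (`B = borderedLaplacian Q p₀`, `π j = [−p₀/qⱼ]`, `ε` the common root bit):

  (Qa) `(B+εI)χ₁ + χ₂ = γ₁π + (τ₁+ετ₂+|χ₁|)𝟙`,  (Qb) `(B+(ε+1)I)χ₂ + χ₁ = γ₂π + ((ε+1)τ₁+τ₂+|χ₂|)𝟙`,
  (Pa) `πᵀχ₁ + |π|γ₁ = σ`,  (Pb) `πᵀχ₂ + |π|γ₂ + γ₂ + γ₁ + τ₁ + τ₂ = 0`,  (∞) `γ₁ + γ₂ + τ₁ + τ₂ = σ`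

(the local conditions of `Sel⁽²⁾(E₀^{(−p₀M)})` at `Q`, `p₀`, `∞` in the E-frame; parts C1-E/F).  This file proves the row-sum
identities, the equivalence of (Qb) with `Φ₃(B)χ₁ = γ₁Bπ + vπ + w𝟙` once `χ₂` is eliminated by (Qa), and the resulting
description of each fibre: for fixed scalars the solutions are exactly `χ₁ ∈ base(s) + ker Φ₃(B)`,
`χ₂ = (B+εI)χ₁ + γ₁π + (τ₁+ετ₂+(1+ε)σ)𝟙`, subject to a condition `cond(s)` on the scalars alone
(`base(s) = γ₁𝟙 + A(s)w_π + C(s)w₁` for preimages `Φ₃(B)w₁ = 𝟙`, `Φ₃(B)w_π = π` of part C1-B,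
`A = εγ₁+γ₂+τ₁+ετ₂+(1+ε)σ`, `C = τ₂+γ₁+σ`; `cond(s) = (∞) ∧ (A·πᵀw_π + C·πᵀw₁ = σ) ∧ (A·𝟙ᵀw_π + C·𝟙ᵀw₁ = (1+ε)σ)`).

Everything is proved; no LINE 49 statement is restated; BSD is not advanced by this file alone.

## References

* [HeathBrown1994SelmerCongruentII] D. R. Heath-Brown, Invent. Math. 118 (1994), §2 (Laplacian/tournament linear algebra).
* [Kane2013SelmerTwists] D. M. Kane, Algebra Number Theory 7 (2013), §2.
-/

namespace Summit.BirchSwinnertonDyer.BirchSwinnertonDyer.Theorems.GenusKolyvaginAtTwo.FullVertex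

open Matrix

/-! ## `𝔽₂` scalar facts -/

/-- `𝔽₂`: `2 = 0`. [folklore] -/
private theorem zmod2_two'' : (2 : ZMod 2) = 0 := by decide

/-- `𝔽₂`: `ε(ε+1) = 0`. [folklore] -/
private theorem zmod2_eps (ε : ZMod 2) : ε * (ε + 1) = 0 := by revert ε; decide

variable (Q : Finset ℕ) (p₀ : ℕ) (hQ : ∀ q ∈ Q, q.Prime) (hQ4 : ∀ q ∈ Q, q % 4 = 3) (hk : Even Q.card)
include hk

/-- `Σ_j c = 0` over `Q` of even size. [folklore] -/
private theorem sum_const_eq_zero (c : ZMod 2) : ∑ _j : Q, c = 0 := by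
  rw [Finset.sum_const, Finset.card_univ, nsmul_eq_mul, Fintype.card_coe]
  obtain ⟨r, hr⟩ := hk
  rw [hr, ← two_mul, Nat.cast_mul, Nat.cast_two, zmod2_two'', zero_mul, zero_mul]

include hQ hQ4

/-! ## Row sums of (Qa), (Qb) -/

/-- Row sum of (Qa): `(1+ε)|χ₁| + |χ₂| + πᵀχ₁ + |π|γ₁ = 0`. [cite: HeathBrown1994SelmerCongruentII, §2] -/
theorem rowsum_Qa {ε τ₁ τ₂ γ₁ : ZMod 2} {χ₁ χ₂ : Q → ZMod 2}
    (hQa : ∀ j : Q, (borderedLaplacian Q p₀ *ᵥ χ₁) j + ε * χ₁ j + χ₂ j =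
      γ₁ * legendreBit (-(p₀ : ℤ)) (j : ℕ) + (τ₁ + ε * τ₂ + ∑ i : Q, χ₁ i)) :
    (1 + ε) * (∑ j : Q, χ₁ j) + (∑ j : Q, χ₂ j) + (∑ j : Q, legendreBit (-(p₀ : ℤ)) (j : ℕ) * χ₁ j) +
      (∑ j : Q, legendreBit (-(p₀ : ℤ)) (j : ℕ)) * γ₁ = 0 := by
  have hsum : ∑ j : Q, ((borderedLaplacian Q p₀ *ᵥ χ₁) j + ε * χ₁ j + χ₂ j) =
      ∑ j : Q, (γ₁ * legendreBit (-(p₀ : ℤ)) (j : ℕ) + (τ₁ + ε * τ₂ + ∑ i : Q, χ₁ i)) :=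
    Finset.sum_congr rfl fun j _ => hQa j
  simp only [Finset.sum_add_distrib, ← Finset.mul_sum, sum_const_eq_zero Q hk, add_zero] at hsum
  rw [sum_mulVec_borderedLaplacian_eq Q p₀ hQ hQ4 hk χ₁] at hsum
  linear_combination (norm := (ring_nf; reduce_mod_char)) hsum

/-- Row sum of (Qb): `ε|χ₂| + |χ₁| + πᵀχ₂ + |π|γ₂ = 0`. [cite: HeathBrown1994SelmerCongruentII, §2] -/
theorem rowsum_Qb {ε τ₁ τ₂ γ₂ : ZMod 2} {χ₁ χ₂ : Q → ZMod 2}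
    (hQb : ∀ j : Q, (borderedLaplacian Q p₀ *ᵥ χ₂) j + (ε + 1) * χ₂ j + χ₁ j =
      γ₂ * legendreBit (-(p₀ : ℤ)) (j : ℕ) + ((ε + 1) * τ₁ + τ₂ + ∑ i : Q, χ₂ i)) :
    ε * (∑ j : Q, χ₂ j) + (∑ j : Q, χ₁ j) + (∑ j : Q, legendreBit (-(p₀ : ℤ)) (j : ℕ) * χ₂ j) +
      (∑ j : Q, legendreBit (-(p₀ : ℤ)) (j : ℕ)) * γ₂ = 0 := by
  have hsum : ∑ j : Q, ((borderedLaplacian Q p₀ *ᵥ χ₂) j + (ε + 1) * χ₂ j + χ₁ j) =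
      ∑ j : Q, (γ₂ * legendreBit (-(p₀ : ℤ)) (j : ℕ) + ((ε + 1) * τ₁ + τ₂ + ∑ i : Q, χ₂ i)) :=
    Finset.sum_congr rfl fun j _ => hQb j
  simp only [Finset.sum_add_distrib, ← Finset.mul_sum, sum_const_eq_zero Q hk, add_zero] at hsum
  rw [sum_mulVec_borderedLaplacian_eq Q p₀ hQ hQ4 hk χ₂] at hsum
  linear_combination (norm := (ring_nf; reduce_mod_char)) hsum

/-! ## (Qb) given (Qa): `Φ₃(B)χ₁ = γ₁Bπ + vπ + w𝟙` -/

omit hQ hQ4 hk in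
/-- With `χ₂ = (B+εI)χ₁ + γ₁π + c𝟙`, row (Qb) at `j` reads
`(Φ₃(B)χ₁) j = γ₁(Bπ) j + (γ₂ + c + (ε+1)γ₁)π j + ((ε+1)c + d)` where `d` is (Qb)'s constant.
[cite: HeathBrown1994SelmerCongruentII, §2] -/
theorem Qb_iff_phi3 {ε γ₁ γ₂ c d : ZMod 2} {χ₁ χ₂ : Q → ZMod 2}
    (hχ₂ : ∀ j : Q, χ₂ j = (borderedLaplacian Q p₀ *ᵥ χ₁) j + ε * χ₁ j + γ₁ * legendreBit (-(p₀ : ℤ)) (j : ℕ) + c)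
    (j : Q) :
    ((borderedLaplacian Q p₀ *ᵥ χ₂) j + (ε + 1) * χ₂ j + χ₁ j = γ₂ * legendreBit (-(p₀ : ℤ)) (j : ℕ) + d) ↔
    ((phi3 (borderedLaplacian Q p₀) *ᵥ χ₁) j =
      γ₁ * (borderedLaplacian Q p₀ *ᵥ fun i : Q => legendreBit (-(p₀ : ℤ)) (i : ℕ)) j +
        (γ₂ + c + (ε + 1) * γ₁) * legendreBit (-(p₀ : ℤ)) (j : ℕ) + ((ε + 1) * c + d)) := by
  have hvec : χ₂ = borderedLaplacian Q p₀ *ᵥ χ₁ + ε • χ₁ + γ₁ • (fun i : Q => legendreBit (-(p₀ : ℤ)) (i : ℕ)) +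
      fun _ => c := by
    ext i; simp only [Pi.add_apply, Pi.smul_apply, smul_eq_mul, hχ₂ i]
  have hB : (borderedLaplacian Q p₀ *ᵥ χ₂) j =
      (borderedLaplacian Q p₀ *ᵥ (borderedLaplacian Q p₀ *ᵥ χ₁)) j + ε * (borderedLaplacian Q p₀ *ᵥ χ₁) j +
        γ₁ * (borderedLaplacian Q p₀ *ᵥ fun i : Q => legendreBit (-(p₀ : ℤ)) (i : ℕ)) j +
          c * legendreBit (-(p₀ : ℤ)) (j : ℕ) := by
    rw [hvec, mulVec_add, mulVec_add, mulVec_add, mulVec_smul, mulVec_smul, borderedLaplacian_mulVec_const]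
    simp only [Pi.add_apply, Pi.smul_apply, smul_eq_mul]
  rw [hB, hχ₂ j, phi3_mulVec]
  simp only [Pi.add_apply]
  have hε : ε * (ε + 1) = 0 := zmod2_eps ε
  constructor
  · intro h
    linear_combination (norm := (ring_nf; reduce_mod_char)) h + (χ₁ j) * hε
  · intro h
    linear_combination (norm := (ring_nf; reduce_mod_char)) h + (χ₁ j) * hε


/-! ## Scalar identities for the fibre theorem -/

omit hQ hQ4 hk in
/-- `𝔽₂`: the two parity relations determine `|χ₁|, |χ₂|`. [folklore] -/
private theorem zmod2_par (ε σ a b : ZMod 2) (h1 : (1 + ε) * a + b = σ) (h2 : ε * b + a = σ) :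
    a = (1 + ε) * σ ∧ b = ε * σ := by
  revert ε σ a b h1 h2; decide

omit hQ hQ4 hk in
/-- `𝔽₂`: the `π`-coefficient of `Φ₃(B)(χ₁ + base)` vanishes. [folklore] -/
private theorem zmod2_coefπ (ε σ τ₁ τ₂ γ₁ γ₂ : ZMod 2) :
    γ₂ + (τ₁ + ε * τ₂ + (1 + ε) * σ) + (ε + 1) * γ₁ + γ₁ + (ε * γ₁ + γ₂ + τ₁ + ε * τ₂ + (1 + ε) * σ) = 0 := by
  revert ε σ τ₁ τ₂ γ₁ γ₂; decide

omit hQ hQ4 hk in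
/-- `𝔽₂`: the `𝟙`-coefficient of `Φ₃(B)(χ₁ + base)` vanishes. [folklore] -/
private theorem zmod2_coef1 (ε σ τ₁ τ₂ γ₁ : ZMod 2) :
    (ε + 1) * (τ₁ + ε * τ₂ + (1 + ε) * σ) + ((ε + 1) * τ₁ + τ₂ + ε * σ) + γ₁ + (τ₂ + γ₁ + σ) = 0 := by
  revert ε σ τ₁ τ₂ γ₁; decide

omit hQ hQ4 hk in
/-- `𝔽₂`: `(1+ε)²σ + σ = εσ`. [folklore] -/
private theorem zmod2_b (ε σ : ZMod 2) : (1 + ε) * ((1 + ε) * σ) + σ = ε * σ := by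
  revert ε σ; decide

omit hQ hQ4 hk in
/-- `𝔽₂`: `ε(εσ) + (1+ε)σ = σ`. [folklore] -/
private theorem zmod2_S4 (ε σ : ZMod 2) : ε * (ε * σ) + (1 + ε) * σ = σ := by
  revert ε σ; decide

/-! ## The fibre theorem -/

/-- **THE FIBRES OF THE UNIFIED `C₁` SYSTEM.**  For preimages `Φ₃(B)w₁ = 𝟙`, `Φ₃(B)w_π = π` and scalars
`s = (σ, τ₁, τ₂, γ₁, γ₂)` with `A = εγ₁+γ₂+τ₁+ετ₂+(1+ε)σ`, `C = τ₂+γ₁+σ`: the pair `(χ₁, χ₂)` solves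
(Qa) ∧ (Qb) ∧ (Pa) ∧ (Pb) ∧ (∞) iff `χ₁ + γ₁𝟙 + A w_π + C w₁ ∈ ker Φ₃(B)`, `χ₂ = (B+εI)χ₁ + γ₁π + (τ₁+ετ₂+(1+ε)σ)𝟙`,
and the scalars satisfy `(∞)`, `A·πᵀw_π + C·πᵀw₁ = σ`, `A·𝟙ᵀw_π + C·𝟙ᵀw₁ = (1+ε)σ`.
[cite: HeathBrown1994SelmerCongruentII, §2] [cite: Kane2013SelmerTwists, §2] -/
theorem sysC1_iff {w₁ wπ : Q → ZMod 2} (h₁ : phi3 (borderedLaplacian Q p₀) *ᵥ w₁ = fun _ => 1)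
    (hπ : phi3 (borderedLaplacian Q p₀) *ᵥ wπ = fun j : Q => legendreBit (-(p₀ : ℤ)) (j : ℕ))
    (ε σ τ₁ τ₂ γ₁ γ₂ A C : ZMod 2) (hA : A = ε * γ₁ + γ₂ + τ₁ + ε * τ₂ + (1 + ε) * σ) (hC : C = τ₂ + γ₁ + σ)
    (χ₁ χ₂ : Q → ZMod 2) :
    ((∀ j : Q, (borderedLaplacian Q p₀ *ᵥ χ₁) j + ε * χ₁ j + χ₂ j =
        γ₁ * legendreBit (-(p₀ : ℤ)) (j : ℕ) + (τ₁ + ε * τ₂ + ∑ i : Q, χ₁ i)) ∧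
      (∀ j : Q, (borderedLaplacian Q p₀ *ᵥ χ₂) j + (ε + 1) * χ₂ j + χ₁ j =
        γ₂ * legendreBit (-(p₀ : ℤ)) (j : ℕ) + ((ε + 1) * τ₁ + τ₂ + ∑ i : Q, χ₂ i)) ∧
      (∑ j : Q, legendreBit (-(p₀ : ℤ)) (j : ℕ) * χ₁ j + (∑ j : Q, legendreBit (-(p₀ : ℤ)) (j : ℕ)) * γ₁ = σ) ∧
      (∑ j : Q, legendreBit (-(p₀ : ℤ)) (j : ℕ) * χ₂ j + (∑ j : Q, legendreBit (-(p₀ : ℤ)) (j : ℕ)) * γ₂ +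
        γ₂ + γ₁ + τ₁ + τ₂ = 0) ∧
      (γ₁ + γ₂ + τ₁ + τ₂ = σ)) ↔
    ((phi3 (borderedLaplacian Q p₀) *ᵥ (χ₁ + fun j : Q => γ₁ + A * wπ j + C * w₁ j) = 0) ∧
      (∀ j : Q, χ₂ j = (borderedLaplacian Q p₀ *ᵥ χ₁) j + ε * χ₁ j + γ₁ * legendreBit (-(p₀ : ℤ)) (j : ℕ) +
        (τ₁ + ε * τ₂ + (1 + ε) * σ)) ∧
      ((γ₁ + γ₂ + τ₁ + τ₂ = σ) ∧
        (A * (∑ j : Q, legendreBit (-(p₀ : ℤ)) (j : ℕ) * wπ j) + C * (∑ j : Q, legendreBit (-(p₀ : ℤ)) (j : ℕ) * w₁ j)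
          = σ) ∧
        (A * (∑ j : Q, wπ j) + C * (∑ j : Q, w₁ j) = (1 + ε) * σ))) := by
  -- abbreviations (all facts are stated with the full names)
  set B := borderedLaplacian Q p₀ with hB
  set base : Q → ZMod 2 := fun j : Q => γ₁ + A * wπ j + C * w₁ j with hbase
  -- `B𝟙 = π`, `Φ𝟙 = Bπ + π + 𝟙`, `Φ base`
  have hB1 : B *ᵥ (fun _ => (1 : ZMod 2)) = (fun i : Q => legendreBit (-(p₀ : ℤ)) (i : ℕ)) := by
    rw [hB, borderedLaplacian_mulVec_const]; ext j; rw [one_mul]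
  have hΦ1 : ∀ j : Q, (phi3 B *ᵥ fun _ => (1 : ZMod 2)) j = (B *ᵥ (fun i : Q => legendreBit (-(p₀ : ℤ)) (i : ℕ))) j + legendreBit (-(p₀ : ℤ)) ((j : Q) : ℕ) + 1 := by
    intro j; rw [phi3_mulVec, hB1]; rfl
  have hΦbase : ∀ j : Q, (phi3 B *ᵥ base) j = γ₁ * ((B *ᵥ (fun i : Q => legendreBit (-(p₀ : ℤ)) (i : ℕ))) j + legendreBit (-(p₀ : ℤ)) ((j : Q) : ℕ) + 1) + A * legendreBit (-(p₀ : ℤ)) ((j : Q) : ℕ) + C := by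
    intro j
    have : base = γ₁ • (fun _ => (1 : ZMod 2)) + A • wπ + C • w₁ := by
      ext i; simp only [hbase, Pi.add_apply, Pi.smul_apply, smul_eq_mul, mul_one]
    rw [this, mulVec_add, mulVec_add, mulVec_smul, mulVec_smul, mulVec_smul, h₁, hπ]
    simp only [Pi.add_apply, Pi.smul_apply, smul_eq_mul, hΦ1, mul_one]
  -- sums of `base`
  have hsum_base : ∑ j : Q, base j = A * (∑ j : Q, wπ j) + C * (∑ j : Q, w₁ j) := by
    simp only [hbase, Finset.sum_add_distrib, ← Finset.mul_sum, sum_const_eq_zero Q hk, zero_add]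
  have hπsum_base : ∑ j : Q, legendreBit (-(p₀ : ℤ)) ((j : Q) : ℕ) * base j = (∑ j : Q, legendreBit (-(p₀ : ℤ)) ((j : Q) : ℕ)) * γ₁ + A * (∑ j : Q, legendreBit (-(p₀ : ℤ)) ((j : Q) : ℕ) * wπ j) +
      C * (∑ j : Q, legendreBit (-(p₀ : ℤ)) ((j : Q) : ℕ) * w₁ j) := by
    simp only [hbase, mul_add, Finset.sum_add_distrib, Finset.sum_mul, Finset.mul_sum]
    refine congrArg₂ _ (congrArg₂ _ rfl (Finset.sum_congr rfl fun j _ => by ring))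
      (Finset.sum_congr rfl fun j _ => by ring)
  -- K-lemma consequences for `κ = χ₁ + base`
  have hKsums : phi3 B *ᵥ (χ₁ + base) = 0 →
      (∑ j : Q, χ₁ j = A * (∑ j : Q, wπ j) + C * (∑ j : Q, w₁ j)) ∧
      (∑ j : Q, legendreBit (-(p₀ : ℤ)) ((j : Q) : ℕ) * χ₁ j = (∑ j : Q, legendreBit (-(p₀ : ℤ)) ((j : Q) : ℕ)) * γ₁ + A * (∑ j : Q, legendreBit (-(p₀ : ℤ)) ((j : Q) : ℕ) * wπ j) + C * (∑ j : Q, legendreBit (-(p₀ : ℤ)) ((j : Q) : ℕ) * w₁ j)) := by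
    intro hK
    have h := sum_eq_zero_of_phi3_mulVec_eq_zero Q p₀ hQ hQ4 hk hK
    simp only [Pi.add_apply, Finset.sum_add_distrib, mul_add] at h
    rw [hsum_base] at h
    rw [hπsum_base] at h
    constructor
    · linear_combination (norm := (ring_nf; reduce_mod_char)) h.1
    · linear_combination (norm := (ring_nf; reduce_mod_char)) h.2
  constructor
  · rintro ⟨hQa, hQb, hPa, hPb, hinf⟩
    -- parities
    have r1 := rowsum_Qa Q p₀ hQ hQ4 hk hQa
    have r2 := rowsum_Qb Q p₀ hQ hQ4 hk hQb
    have hPb' : ∑ j : Q, legendreBit (-(p₀ : ℤ)) ((j : Q) : ℕ) * χ₂ j + (∑ j : Q, legendreBit (-(p₀ : ℤ)) ((j : Q) : ℕ)) * γ₂ = σ := by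
      linear_combination (norm := (ring_nf; reduce_mod_char)) hPb + hinf
    obtain ⟨ha, hb⟩ := zmod2_par ε σ (∑ j : Q, χ₁ j) (∑ j : Q, χ₂ j)
      (by linear_combination (norm := (ring_nf; reduce_mod_char)) r1 + hPa)
      (by linear_combination (norm := (ring_nf; reduce_mod_char)) r2 + hPb')
    -- `χ₂`
    have hχ₂ : ∀ j : Q, χ₂ j = (B *ᵥ χ₁) j + ε * χ₁ j + γ₁ * legendreBit (-(p₀ : ℤ)) ((j : Q) : ℕ) + (τ₁ + ε * τ₂ + (1 + ε) * σ) := by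
      intro j
      have e := hQa j
      rw [ha] at e
      linear_combination (norm := (ring_nf; reduce_mod_char)) e
    -- `Φχ₁`
    have hΦχ₁ : ∀ j : Q, (phi3 B *ᵥ χ₁) j = γ₁ * (B *ᵥ (fun i : Q => legendreBit (-(p₀ : ℤ)) (i : ℕ))) j +
        (γ₂ + (τ₁ + ε * τ₂ + (1 + ε) * σ) + (ε + 1) * γ₁) * legendreBit (-(p₀ : ℤ)) ((j : Q) : ℕ) +
          ((ε + 1) * (τ₁ + ε * τ₂ + (1 + ε) * σ) + ((ε + 1) * τ₁ + τ₂ + ε * σ)) := by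
      intro j
      have e := hQb j
      rw [hb] at e
      exact (Qb_iff_phi3 Q p₀ hχ₂ j).mp e
    have hK : phi3 B *ᵥ (χ₁ + base) = 0 := by
      ext j
      rw [mulVec_add, Pi.add_apply, hΦχ₁ j, hΦbase j, Pi.zero_apply]
      have c1 := zmod2_coefπ ε σ τ₁ τ₂ γ₁ γ₂
      have c2 := zmod2_coef1 ε σ τ₁ τ₂ γ₁
      rw [← hA] at c1; rw [← hC] at c2
      linear_combination (norm := (ring_nf; reduce_mod_char)) (legendreBit (-(p₀ : ℤ)) ((j : Q) : ℕ)) * c1 + c2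
    obtain ⟨hs1, hs2⟩ := hKsums hK
    refine ⟨hK, hχ₂, hinf, ?_, ?_⟩
    · rw [hs2] at hPa
      linear_combination (norm := (ring_nf; reduce_mod_char)) hPa
    · rw [← hs1, ha]
  · rintro ⟨hK, hχ₂, hinf, hc2, hc1⟩
    obtain ⟨hs1, hs2⟩ := hKsums hK
    have ha : ∑ j : Q, χ₁ j = (1 + ε) * σ := by rw [hs1, hc1]
    have hPa : ∑ j : Q, legendreBit (-(p₀ : ℤ)) ((j : Q) : ℕ) * χ₁ j + (∑ j : Q, legendreBit (-(p₀ : ℤ)) ((j : Q) : ℕ)) * γ₁ = σ := by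
      rw [hs2]; linear_combination (norm := (ring_nf; reduce_mod_char)) hc2
    -- (Qa)
    have hQa : ∀ j : Q, (B *ᵥ χ₁) j + ε * χ₁ j + χ₂ j = γ₁ * legendreBit (-(p₀ : ℤ)) ((j : Q) : ℕ) + (τ₁ + ε * τ₂ + ∑ i : Q, χ₁ i) := by
      intro j; rw [hχ₂ j, ha]; linear_combination (norm := (ring_nf; reduce_mod_char))
    -- `|χ₂|`
    have hb : ∑ j : Q, χ₂ j = ε * σ := by
      have e : ∑ j : Q, χ₂ j = ∑ j : Q, ((B *ᵥ χ₁) j + ε * χ₁ j + γ₁ * legendreBit (-(p₀ : ℤ)) ((j : Q) : ℕ) + (τ₁ + ε * τ₂ + (1 + ε) * σ)) :=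
        Finset.sum_congr rfl fun j _ => hχ₂ j
      simp only [Finset.sum_add_distrib, ← Finset.mul_sum, sum_const_eq_zero Q hk, add_zero] at e
      rw [hB, sum_mulVec_borderedLaplacian_eq Q p₀ hQ hQ4 hk χ₁] at e
      rw [e]
      have := zmod2_b ε σ
      linear_combination hPa + (1 + ε) * ha + this
    -- (Qb)
    have hΦχ₁ : ∀ j : Q, (phi3 B *ᵥ χ₁) j = (phi3 B *ᵥ base) j := by
      intro j
      have e := congr_fun hK j
      rw [mulVec_add, Pi.add_apply, Pi.zero_apply] at e
      linear_combination (norm := (ring_nf; reduce_mod_char)) e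
    have hQb : ∀ j : Q, (B *ᵥ χ₂) j + (ε + 1) * χ₂ j + χ₁ j = γ₂ * legendreBit (-(p₀ : ℤ)) ((j : Q) : ℕ) + ((ε + 1) * τ₁ + τ₂ + ∑ i : Q, χ₂ i) := by
      intro j
      rw [hb]
      refine (Qb_iff_phi3 Q p₀ hχ₂ j).mpr ?_
      rw [hΦχ₁ j, hΦbase j, hB]
      have c1 := zmod2_coefπ ε σ τ₁ τ₂ γ₁ γ₂
      have c2 := zmod2_coef1 ε σ τ₁ τ₂ γ₁
      rw [← hA] at c1; rw [← hC] at c2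
      linear_combination (norm := (ring_nf; reduce_mod_char)) (legendreBit (-(p₀ : ℤ)) ((j : Q) : ℕ)) * c1 + c2
    -- (Pb)
    have r2 := rowsum_Qb Q p₀ hQ hQ4 hk hQb
    rw [ha, hb] at r2
    have hS4 := zmod2_S4 ε σ
    refine ⟨hQa, hQb, hPa, ?_, hinf⟩
    linear_combination (norm := (ring_nf; reduce_mod_char)) r2 + hS4 + hinf

end Summit.BirchSwinnertonDyer.BirchSwinnertonDyer.Theorems.GenusKolyvaginAtTwo.FullVertex
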